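import Summits.ResolutionOfSingularities.ResolutionOfSingularities.Theorems.MarkedTransferCampaignW46ThreefoldsRegime
import Literature.AlgebraicGeometry.Resolution.IdealSheafLemmas
import Literature.AlgebraicGeometry.Resolution.MarkedIdealsLemmas
import Mathlib.AlgebraicGeometry.Morphisms.Smooth
import Mathlib.RingTheory.RingHom.Smooth
import Mathlib.RingTheory.KrullDimension.Polynomial
import Mathlib.RingTheory.KrullDimension.Field
import HarnessLib

/-!
# [OURS · L1 W4.6 rung (ii)] A KERNEL INHABITANT of the standard unresolved threefold-hypersurface states: the double
# plane `(x₂², 2)` in affine 3-space — non-vacuity of the class `regimeII ∧ IsStandard ∧ Sing ≠ ∅` that `ResumesCover` quantifies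
# over (bookkeeping definitions + proofs)

Cell res-hironaka, LADDER-RESOLUTION rung L (D-0089), slot W4.6, rung (ii); seat res-L1-s46-pv-3 (gen 2). Host route
MarkedTransfer, host item `HypersurfaceOrderReductionDimLeThree` (stmt-16156); `--kind definition --supports` it.

HONEST FRAMING. OURS bookkeeping (a concrete ambient datum and ideal exponent) and kernel facts about them; NOTHING here is a
statement of H. Hironaka's manuscript (2017-03-23, [Hironaka2017]) and nothing asserts that any statement of it holds. It shows
only that the hypothesis class of `ResumesCover N Rd (regimeII ∧ IsStandard ∧ Sing ≠ ∅)` (capstone of rung (ii),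
`…ThreefoldsStepExistsGeneral`, `…ThreefoldsGammaFree`) is NOT EMPTY — it says nothing about résumés. AI review is weaker
than expert review.

Contents: `ZA3 K = Spec K[x₀, x₁, x₂]`, `spaceAmbientDatum K p` (row-001 ambient datum on it; pattern of res-L1-s46-pv-1's
`planeAmbientDatum` and res-type-065's `ZA2`), `secOf3` (global sections of `ZA3`), `planeIdeal K` (the ideal sheaf `(x₂)`),
`doublePlaneExponent K p = ((x₂)², 2)`; theorems: dimension `≤ 3`, `(x₂)` and `(x₂)²` effective Cartier, the state is in
`regimeII`, standard, and its singular locus contains the plane `{x₂ = 0}` (non-empty): `doublePlane_witness`.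

References: `…ThreefoldsRegime` (p480316); pv-1 `…ProcrastinationPlane` (p473754); res-type-065 `Rem924ENeg.lean` (the
`ZA2` pattern); tree `IdealSheafLemmas.ideal_ofIdealTop_top`, `BlowupsProduct.IsEffectiveCartier.pow`,
`MarkedIdealsLemmas.stalkIdeal_pow`; Mathlib `MvPolynomial.ringKrullDim_of_isNoetherianRing`, `basicOpen_eq_of_affine`. [folklore]
-/

noncomputable section

set_option linter.dupNamespace false -- mandated namespace of this single-conjunct summit

open CategoryTheory AlgebraicGeometry TopologicalSpace

namespace Summit.ResolutionOfSingularities.ResolutionOfSingularities.Theorems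

namespace CampaignW46

open Literature.AlgebraicGeometry.Resolution
open Literature.AlgebraicGeometry.Hironaka2017.S02Preliminaries

universe u

section Space

variable (K : Type u) [Field K]

/-- [OURS] The coordinate ring `K[x₀, x₁, x₂]` of affine 3-space. Bookkeeping. [folklore] -/
abbrev R3 : Type u := MvPolynomial (Fin 3) K

/-- [OURS] Affine 3-space `Spec K[x₀, x₁, x₂]`. Bookkeeping. [folklore] -/
abbrev ZA3 : Scheme.{u} := Spec (CommRingCat.of (R3 K))

/-- [OURS] Global sections of affine 3-space from polynomials (the inverse of `ΓSpecIso`). Bookkeeping. [folklore] -/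
def secOf3 : R3 K →+* Γ(ZA3 K, ⊤) := (Scheme.ΓSpecIso (CommRingCat.of (R3 K))).inv.hom

/-- `secOf3` is injective (an isomorphism). [folklore] -/
theorem secOf3_injective : Function.Injective (secOf3 K) :=
  (ConcreteCategory.bijective_of_isIso (Scheme.ΓSpecIso (CommRingCat.of (R3 K))).inv).1

/-- `secOf3` is surjective (an isomorphism). [folklore] -/
theorem secOf3_surjective : Function.Surjective (secOf3 K) :=
  (ConcreteCategory.bijective_of_isIso (Scheme.ΓSpecIso (CommRingCat.of (R3 K))).inv).2

/-- The global section `x₂` is a nonzerodivisor (its ring of global sections is the domain `K[x₀, x₁, x₂]`). [folklore] -/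
theorem secOf3_X_mem_nonZeroDivisors : secOf3 K (MvPolynomial.X 2) ∈ nonZeroDivisors Γ(ZA3 K, ⊤) := by
  rw [mem_nonZeroDivisors_iff_right]
  intro a ha
  obtain ⟨b, rfl⟩ := secOf3_surjective K a
  have h1 : secOf3 K (b * MvPolynomial.X 2) = secOf3 K 0 := by rw [map_mul, map_zero]; exact ha
  have h2 : b * MvPolynomial.X 2 = 0 := secOf3_injective K h1
  rcases mul_eq_zero.mp h2 with h | h
  · rw [h, map_zero]
  · exact absurd h (MvPolynomial.X_ne_zero 2)

/-- `Spec K[x₀, x₁, x₂] → Spec K` is smooth (a polynomial algebra is smooth). [folklore] -/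
theorem smooth_specSpace : Smooth (Spec.map (CommRingCat.ofHom (algebraMap K (R3 K)))) := by
  rw [HasRingHomProperty.Spec_iff (P := @Smooth)]
  have : Algebra.Smooth K (R3 K) := {}
  exact RingHom.smooth_algebraMap.mpr this

/-- `dim Spec K[x₀, x₁, x₂] ≤ 3`. [folklore] -/
theorem topologicalKrullDim_ZA3_le : topologicalKrullDim (ZA3 K) ≤ ((3 : ℕ) : WithBot ℕ∞) := by
  show topologicalKrullDim (PrimeSpectrum (R3 K)) ≤ _
  rw [PrimeSpectrum.topologicalKrullDim_eq_ringKrullDim, MvPolynomial.ringKrullDim_of_isNoetherianRing,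
    ringKrullDim_eq_zero_of_field, zero_add]
  simp

/-! ## The plane ideal `(x₂)` and the double plane `((x₂)², 2)` -/

/-- [OURS · L1 W4.6] NOT a statement of the manuscript. The ideal sheaf `𝓘 = (x₂)` of the coordinate plane `{x₂ = 0}` in
affine 3-space. Bookkeeping. [folklore] -/
def planeIdeal : (ZA3 K).IdealSheafData :=
  Scheme.IdealSheafData.ofIdealTop (Ideal.span {secOf3 K (MvPolynomial.X 2)})

/-- `𝓘 = (x₂)` is an effective Cartier ideal (principal, generated by a nonzerodivisor, on the affine scheme). [folklore] -/
theorem planeIdeal_isEffectiveCartier : IsEffectiveCartier (planeIdeal K) := by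
  intro x
  exact ⟨⟨⊤, isAffineOpen_top _⟩, trivial, secOf3 K (MvPolynomial.X 2), secOf3_X_mem_nonZeroDivisors K,
    ideal_ofIdealTop_top _⟩

/-- A point of affine 3-space whose prime contains `x₂` lies in the support of `𝓘 = (x₂)`. [folklore] -/
theorem mem_support_planeIdeal {η : ZA3 K} (hη : (MvPolynomial.X 2 : R3 K) ∈ (η : PrimeSpectrum (R3 K)).asIdeal) :
    η ∈ (planeIdeal K).support := by
  rw [← SetLike.mem_coe]
  change η ∈ ((Scheme.IdealSheafData.ofIdealTop (Ideal.span {secOf3 K (MvPolynomial.X 2)})).support : Set (ZA3 K))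
  rw [Scheme.IdealSheafData.coe_support_ofIdealTop, Scheme.zeroLocus_span, Scheme.mem_zeroLocus_iff]
  simp only [Set.mem_singleton_iff, forall_eq]
  change η ∉ (ZA3 K).basicOpen ((Scheme.ΓSpecIso (CommRingCat.of (R3 K))).inv.hom (MvPolynomial.X 2))
  rw [basicOpen_eq_of_affine]
  exact fun h => (PrimeSpectrum.mem_basicOpen (MvPolynomial.X 2 : R3 K) η).mp h hη

/-- The support of `𝓘 = (x₂)` is non-empty: `(x₂)` is a proper ideal (it dies under evaluation at `0`), so it lies in a
maximal ideal, a point of the plane. [folklore] -/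
theorem planeIdeal_support_nonempty : ∃ η : ZA3 K, η ∈ (planeIdeal K).support := by
  have hne : Ideal.span {(MvPolynomial.X 2 : R3 K)} ≠ ⊤ := by
    rw [Ne, Ideal.span_singleton_eq_top]
    intro hu
    have h0 := hu.map (MvPolynomial.eval (0 : Fin 3 → K))
    rw [MvPolynomial.eval_X, Pi.zero_apply] at h0
    exact not_isUnit_zero h0
  obtain ⟨𝔪, h𝔪, hle⟩ := Ideal.exists_le_maximal _ hne
  exact ⟨⟨𝔪, h𝔪.isPrime⟩, mem_support_planeIdeal K (hle (Ideal.mem_span_singleton_self _))⟩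

variable (p : ℕ) [Fact p.Prime] [CharP K p]

/-- [OURS · L1 W4.6] NOT a statement of the manuscript. Affine 3-space `Spec K[x₀, x₁, x₂] → Spec K` as a row-001 ambient
datum (irreducible: spectrum of a domain; smooth: polynomial algebra; quasi-compact: affine). Bookkeeping. [folklore] -/
def spaceAmbientDatum : AmbientDatum p K where
  Z := ZA3 K
  hom := Spec.map (CommRingCat.ofHom (algebraMap K (R3 K)))
  irreducible := inferInstanceAs (IrreducibleSpace (PrimeSpectrum (R3 K)))
  smooth := smooth_specSpace K
  quasiCompact := inferInstance

/-- [OURS · L1 W4.6] NOT a statement of the manuscript. THE DOUBLE PLANE: the ideal exponent `((x₂)², 2)` on affine 3-space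
— a hypersurface exponent of order `2` along the plane `{x₂ = 0}`. Bookkeeping. [folklore] -/
def doublePlaneExponent : IdealExponent (spaceAmbientDatum K p).Z :=
  ⟨planeIdeal K ^ 2, 2⟩

/-- The double plane is a threefold-hypersurface state: `dim ≤ 3` and `(x₂)²` effective Cartier. [folklore] -/
theorem regimeII_doublePlane : regimeII (spaceAmbientDatum K p) (doublePlaneExponent K p) :=
  ⟨topologicalKrullDim_ZA3_le K, (planeIdeal_isEffectiveCartier K).pow 2⟩

/-- Every point of the support of `𝓘 = (x₂)` is a singular point of the double plane: `𝓘_x ⊆ 𝔪_x` there, so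
`(𝓘²)_x = 𝓘_x² ⊆ 𝔪_x²`, i.e. `ord_x (𝓘²) ≥ 2`. [folklore] -/
theorem mem_sing_doublePlane_of_mem_support {x : ZA3 K} (hx : x ∈ (planeIdeal K).support) :
    x ∈ (doublePlaneExponent K p).sing := by
  change ((2 : ℕ) : ℕ∞) ≤ idealOrder (planeIdeal K ^ 2) x
  rw [le_idealOrder_iff, stalkIdeal_pow]
  exact Ideal.pow_right_mono ((mem_support_iff_stalkIdeal_le _ x).mp hx) 2

/-- The double plane is standard: `(x₂)² ≠ 0` (its global sections contain the nonzerodivisor `x₂²`) and `2 > 0`.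
[folklore] -/
theorem doublePlaneExponent_isStandard : (doublePlaneExponent K p).IsStandard := by
  refine ⟨fun h => ?_, two_pos⟩
  have hz : secOf3 K (MvPolynomial.X 2) ∈ (planeIdeal K).ideal ⟨⊤, isAffineOpen_top (ZA3 K)⟩ := by
    change secOf3 K (MvPolynomial.X 2) ∈
      (Scheme.IdealSheafData.ofIdealTop (Ideal.span {secOf3 K (MvPolynomial.X 2)})).ideal ⟨⊤, isAffineOpen_top (ZA3 K)⟩
    rw [ideal_ofIdealTop_top]
    exact Ideal.mem_span_singleton_self _
  have hmem : secOf3 K (MvPolynomial.X 2) * secOf3 K (MvPolynomial.X 2) ∈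
      (planeIdeal K ^ 2).ideal ⟨⊤, isAffineOpen_top (ZA3 K)⟩ := by
    rw [Scheme.IdealSheafData.ideal_pow, Pi.pow_apply, pow_two]
    exact Ideal.mul_mem_mul hz hz
  have hbot : (planeIdeal K ^ 2).ideal ⟨⊤, isAffineOpen_top (ZA3 K)⟩ = ⊥ := by
    change (doublePlaneExponent K p).J.ideal _ = ⊥
    rw [h]
    rfl
  rw [hbot, Ideal.mem_bot] at hmem
  exact nonZeroDivisors.ne_zero (mul_mem (secOf3_X_mem_nonZeroDivisors K) (secOf3_X_mem_nonZeroDivisors K)) hmem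

/-- **NON-VACUITY.** The double plane in affine 3-space is a STANDARD, UNRESOLVED threefold-hypersurface state: the class
`regimeII ∧ IsStandard ∧ Sing ≠ ∅` over which `ResumesCover` quantifies in the capstone of rung (ii) is inhabited (for every
prime `p` and field `K` of characteristic `p`). [folklore] -/
theorem doublePlane_witness :
    regimeII (spaceAmbientDatum K p) (doublePlaneExponent K p) ∧ (doublePlaneExponent K p).IsStandard ∧
      (doublePlaneExponent K p).sing.Nonempty := by
  obtain ⟨x, hx⟩ := planeIdeal_support_nonempty K
  exact ⟨regimeII_doublePlane K p, doublePlaneExponent_isStandard K p, ⟨x, mem_sing_doublePlane_of_mem_support K p hx⟩⟩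

end Space

end CampaignW46

end Summit.ResolutionOfSingularities.ResolutionOfSingularities.Theorems

end
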